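import Literature.Barriers.QuantumAdvantage.FFKLGenericCollapse
import Literature.Computability.Complexity.PSpaceGapThreshold
import Literature.Computability.Complexity.CountingHierarchyPH
import Literature.Computability.Complexity.OracleClosure
import HarnessLib

/-!
# The `AWPP` promise against an explicitly given oracle table is a `PSPACE` predicate (Fenner–Fortnow–Kurtz–Li, Lemma 6.17: "`F_j ∈ FPSPACE` for `AWPP`")

Support file for the Standard Algorithm half of
`Literature.Barriers.QuantumAdvantage.fennerFortnowKurtzLi2003_thm618_awpp`
(`FFKLGenericCollapse.lean` reduces the named fact to the collapse of categorical
descriptions, `fennerFortnowKurtzLi2003_thm618_awpp_of_stdAlg`). Fenner–Fortnow–Kurtz–Li,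
Inform. and Comput. 182 (2003), proof sketch of **Lemma 6.17** (p. 33): the certificate tests of
the Standard Algorithm evaluate the machine "`M^{α∪β∪γ}(x)` …, where all queries outside
`dom(α ∪ β ∪ γ)` are answered negatively" — i.e. against a FINITE, EXPLICITLY GIVEN oracle — and
"Given Lemma 6.17 it is easy to see that `F_j ∈ FPSPACE` for `C^A = AWPP^A`".

This file proves the base step of that remark in the tree's models: for a well-formed `AWPP`
description `Δ` (`AWPPDescr`, two counting machines against `B ⊕ Z`), a base oracle
`B ∈ PSPACE` with a Karp-`PSPACE`-complete set at hand, and ANY table semantics given by a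
lookup language `TBL ∈ PSPACE` (`tableLang TBL t = {w | ⟨t, w⟩ ∈ TBL}`, the oracle denoted by the
table code `t`; the concrete layered tables of the certificate logic are the next file's),

* `FFKL.jointOracle B TBL = {⟨t, s⟩ | s ∈ B ⊕ tableLang TBL t}` is in `PSPACE`
  (`jointOracle_mem_PSPACE`: a union of two tagged preimages, `PSpaceClosure.lean`);
* the SIMULATED RELATION `FFKL.simRel B TBL M q = {⟨⟨x, t⟩, y⟩ | M^{B ⊕ Z_t}(⟨x, y⟩) accepts within
  q(|⟨x,y⟩|)}` of a machine `M` that outputs on every run and asks short queries is in `PSPACE`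
  (`simRel_mem_PSPACE`): the machine `(M.comap π).mapQuery tag` — run `M` on `⟨x, y⟩`, tag each
  query `s` with the table, `s ↦ ⟨t, s⟩` — decides it relative to the single oracle
  `jointOracle B TBL` (`OracleQueryMap.lean`: `run_mapQuery`, `runAux_comap`; the shape of
  `OracleSimulateFP.simAlg`), so it lies in `P^{jointOracle} ⊆ PSPACE`
  (`PRel_subset_PSPACE_of_mem_PSPACE_holds`);
* **`accTable_mem_PSPACE`**: the threshold form of the promise test,
  `{⟨x, t⟩ | 2^{p(|x|)} < 2 · gap_Δ(B ⊕ Z_t, x)}`, is in `PSPACE` (`gapThreshold_mem_PSPACE` of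
  `PSpaceGapThreshold.lean` over the two simulated relations), and `accTable_iff_mem_lang`:
  under the promise `Δ.Prom B Z x` this threshold is exactly `x ∈ Δ.lang B Z` (the described
  language), so the predicate decides `Δ`'s verdict at `x` against the table's oracle whenever the
  table extends the condition `σ` over which `Δ` is categorical.

## References

* [FennerFortnowKurtzLi2003IC] Lemma 6.17 (p. 33) and the remark following it; Def. 6.1.
* S. Arora, B. Barak, CUP 2009, §3.4 (oracle machines; Example 3.6 (2)), §4 (PSPACE).
-/

noncomputable section

namespace Literature.Barriers.QuantumAdvantage

open _root_.Computability Literature.Computability.Complexity Literature.Computability.Complexity.Classes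
  Literature.Computability.QuantumComplexity Polynomial
open scoped Literature.Computability.Complexity.Notation

namespace FFKL

/-! ### Tables and the joint oracle -/

/-- The oracle denoted by the table code `t` under the lookup language `TBL`:
`w ∈ Z_t ↔ ⟨t, w⟩ ∈ TBL`. [cite: FennerFortnowKurtzLi2003IC, Lemma 6.17 (p. 33, "all queries outside dom(α ∪ β ∪ γ) are answered negatively")] -/
def tableLang (TBL : Language Bool) (t : List Bool) : Language Bool :=
  {w | boolPair t w ∈ TBL}

/-- The single oracle answering tagged queries: `⟨t, s⟩ ∈ jointOracle ↔ s ∈ B ⊕ Z_t`.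
[cite: FennerFortnowKurtzLi2003IC, §3.2 p. 14 (rerelativization to B)] -/
def jointOracle (B TBL : Language Bool) : Language Bool :=
  {v | (boolUnpair v).2 ∈ oracleJoin B (tableLang TBL (boolUnpair v).1)}

/-- Membership of a tagged query. [folklore] -/
theorem boolPair_mem_jointOracle (B TBL : Language Bool) (t s : List Bool) :
    boolPair t s ∈ jointOracle B TBL ↔ s ∈ oracleJoin B (tableLang TBL t) := by
  show (boolUnpair (boolPair t s)).2 ∈ oracleJoin B (tableLang TBL (boolUnpair (boolPair t s)).1) ↔ _
  rw [boolUnpair_boolPair]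

/-- **The joint oracle is in `PSPACE`** for `B, TBL ∈ PSPACE` (given a Karp-`PSPACE`-complete set
for the union): `{v | snd v = 0w, w ∈ B} ∪ {v | snd v = 1w, ⟨fst v, w⟩ ∈ TBL}`.
[cite: AroraBarakCC2009, §4.2 (Def. 4.9)] -/
theorem jointOracle_mem_PSPACE {B TBL C : Language Bool} (hC : IsComplete PSPACE C) (hB : B ∈ PSPACE)
    (hT : TBL ∈ PSPACE) : jointOracle B TBL ∈ PSPACE := by
  have h0 : (sndStartsWith false ⊓ ((List.tail ∘ sndP) ⁻¹' B) : Language Bool) ∈ PSPACE :=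
    inter_P_mem_PSPACE (sndStartsWith_mem_P false)
      (preimage_mem_PSPACE hB (comp_mem_FP PRelSigma.tail_mem_FP sndP_mem_FP))
  have h1 : (sndStartsWith true ⊓ (fanoutFn fstP (List.tail ∘ sndP) ⁻¹' TBL) : Language Bool) ∈ PSPACE :=
    inter_P_mem_PSPACE (sndStartsWith_mem_P true)
      (preimage_mem_PSPACE hT (fanoutFn_mem_FP fstP_mem_FP (comp_mem_FP PRelSigma.tail_mem_FP sndP_mem_FP)))
  have key : ∀ v : List Bool, v ∈ jointOracle B TBL ↔
      v ∈ ((sndStartsWith false ⊓ ((List.tail ∘ sndP) ⁻¹' B)) ⊔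
        (sndStartsWith true ⊓ (fanoutFn fstP (List.tail ∘ sndP) ⁻¹' TBL)) : Language Bool) := by
    intro v
    rw [show v ∈ ((sndStartsWith false ⊓ ((List.tail ∘ sndP) ⁻¹' B)) ⊔
        (sndStartsWith true ⊓ (fanoutFn fstP (List.tail ∘ sndP) ⁻¹' TBL)) : Language Bool) ↔
        v ∈ (sndStartsWith false ⊓ ((List.tail ∘ sndP) ⁻¹' B) : Language Bool) ∨
          v ∈ (sndStartsWith true ⊓ (fanoutFn fstP (List.tail ∘ sndP) ⁻¹' TBL) : Language Bool)
        from Iff.rfl, Language.mem_inf, Language.mem_inf, memL_preimage, memL_preimage]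
    -- both sides only look at the two components of `v`
    have hv : v ∈ jointOracle B TBL ↔ (boolUnpair v).2 ∈ oracleJoin B (tableLang TBL (boolUnpair v).1) :=
      Iff.rfl
    have hs0 : v ∈ sndStartsWith false ↔ ((boolUnpair v).2).head? = some false := Iff.rfl
    have hs1 : v ∈ sndStartsWith true ↔ ((boolUnpair v).2).head? = some true := Iff.rfl
    rw [hv, hs0, hs1]
    simp only [Function.comp_apply, fanoutFn_apply]
    rw [show sndP v = (boolUnpair v).2 from rfl, show fstP v = (boolUnpair v).1 from rfl]
    rcases (boolUnpair v).2 with _ | ⟨b, w⟩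
    · simp
    · cases b
      · simp
      · simp only [List.head?_cons, List.tail_cons, true_cons_mem_oracleJoin,
          Option.some.injEq, Bool.true_eq_false, false_and, false_or, true_and]
        exact Iff.rfl
  have heq : jointOracle B TBL =
      ((sndStartsWith false ⊓ ((List.tail ∘ sndP) ⁻¹' B)) ⊔
        (sndStartsWith true ⊓ (fanoutFn fstP (List.tail ∘ sndP) ⁻¹' TBL)) : Language Bool) :=
    Set.ext key
  rw [heq]
  exact union_mem_PSPACE_of_complete hC h0 h1

/-! ### Simulating a machine against the table's oracle -/

/-- The input projection `⟨⟨x, t⟩, y⟩ ↦ ⟨x, y⟩` (on all strings, through the total `boolUnpair`). [folklore] -/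
def projIn : List Bool → List Bool :=
  fanoutFn (fstP ∘ fstP) sndP

/-- The query tagging `⟨w, ⟨as, s⟩⟩ ↦ ⟨t, s⟩`, `t = snd (fst w)`. [folklore] -/
def tagQ : List Bool → List Bool :=
  fanoutFn (sndP ∘ fstP ∘ fstP) (sndP ∘ sndP)

/-- `projIn ∈ FP`. [folklore] -/
theorem projIn_mem_FP : projIn ∈ FP :=
  fanoutFn_mem_FP (comp_mem_FP fstP_mem_FP fstP_mem_FP) sndP_mem_FP

/-- `tagQ ∈ FP`. [folklore] -/
theorem tagQ_mem_FP : tagQ ∈ FP :=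
  fanoutFn_mem_FP (comp_mem_FP sndP_mem_FP (comp_mem_FP fstP_mem_FP fstP_mem_FP))
    (comp_mem_FP sndP_mem_FP sndP_mem_FP)

/-- Value of `projIn`: `projIn w = ⟨fst (fst w), snd w⟩`. [folklore] -/
theorem projIn_apply (w : List Bool) : projIn w = boolPair (fstP (fstP w)) (sndP w) := by
  simp [projIn]

/-- Value of `tagQ` on the argument of a query rewriting. [folklore] -/
theorem tagQ_apply (w A s : List Bool) :
    tagQ (boolPair w (boolPair A s)) = boolPair (sndP (fstP w)) s := by
  simp [tagQ]

/-- **The simulating machine**: run `M` on `⟨x, y⟩` (input `⟨⟨x, t⟩, y⟩`), tagging every query with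
the table code `t` for the joint oracle. [cite: AroraBarakCC2009, §3.4 Example 3.6 (2)] -/
def simMachine (M : OracleAlg Bool) : OracleAlg Bool :=
  (M.comap projIn).mapQuery tagQ

/-- The simulating machine is polynomial-time when `M` is. [cite: AroraBarakCC2009, §3.4] -/
theorem isPolyTime_simMachine {M : OracleAlg Bool} (hM : M.IsPolyTime encodingBoolBool) :
    (simMachine M).IsPolyTime encodingBoolBool :=
  OracleAlg.isPolyTime_mapQuery encodingBoolBool
    (OracleAlg.isPolyTime_comap encodingBoolBool hM projIn_mem_FP) tagQ_mem_FP

/-- **The simulated relation** of `M` with fuel `q`: `w = ⟨⟨x, t⟩, y⟩` is in it iff `M` with oracle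
`B ⊕ Z_t` accepts `⟨x, y⟩` within `q(|⟨x, y⟩|)` rounds (components read through `boolUnpair`).
[cite: FennerFortnowKurtzLi2003IC, Lemma 6.17 (p. 33)] -/
def simRel (B TBL : Language Bool) (M : OracleAlg Bool) (q : Polynomial ℕ) : Language Bool :=
  {w | M.run (Oracle.ofLanguage (oracleJoin B (tableLang TBL (sndP (fstP w)))))
    (q.eval (boolPair (fstP (fstP w)) (sndP w)).length) (boolPair (fstP (fstP w)) (sndP w)) = some true}

/-- Membership of a triple in the simulated relation. [folklore] -/
theorem mem_simRel_iff (B TBL : Language Bool) (M : OracleAlg Bool) (q : Polynomial ℕ) (x t y : List Bool) :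
    boolPair (boolPair x t) y ∈ simRel B TBL M q ↔
      M.run (Oracle.ofLanguage (oracleJoin B (tableLang TBL t))) (q.eval (boolPair x y).length)
        (boolPair x y) = some true := by
  show M.run (Oracle.ofLanguage (oracleJoin B (tableLang TBL (sndP (fstP (boolPair (boolPair x t) y))))))
    (q.eval (boolPair (fstP (fstP (boolPair (boolPair x t) y))) (sndP (boolPair (boolPair x t) y))).length)
    (boolPair (fstP (fstP (boolPair (boolPair x t) y))) (sndP (boolPair (boolPair x t) y))) = some true ↔ _
  rw [fstP_boolPair, fstP_boolPair, sndP_boolPair, sndP_boolPair]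

/-- **The simulated relation is in `PSPACE`** (for `M` polynomial-time, outputting on every run
within its fuel and asking only short queries; `B, TBL ∈ PSPACE`; a Karp-`PSPACE`-complete set at
hand): the simulating machine decides it relative to `jointOracle B TBL`, so it is in
`P^{jointOracle} ⊆ PSPACE`. [cite: FennerFortnowKurtzLi2003IC, Lemma 6.17 (remark, p. 33)] [cite: AroraBarakCC2009, §3.4 and §4.2] -/
theorem simRel_mem_PSPACE {B TBL C : Language Bool} (hC : IsComplete PSPACE C) (hB : B ∈ PSPACE)
    (hT : TBL ∈ PSPACE) {M : OracleAlg Bool} (hM : M.IsPolyTime encodingBoolBool) (q : Polynomial ℕ)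
    (hwf : ∀ (O : Oracle) (z : List Bool), (M.run O (q.eval z.length) z).isSome ∧
      ∀ s ∈ M.queries O (q.eval z.length) z, s.length ≤ q.eval z.length) :
    simRel B TBL M q ∈ PSPACE := by
  refine PRel_subset_PSPACE_of_mem_PSPACE_holds (jointOracle_mem_PSPACE hC hB hT)
    ⟨simMachine M, isPolyTime_simMachine hM, 2 * X + 2 + q.comp (X + 2), fun w => ?_⟩
  -- the two oracles
  have hagree : OracleAlg.MapAgree (M.comap projIn) tagQ (Oracle.ofLanguage (jointOracle B TBL))
      (Oracle.ofLanguage (oracleJoin B (tableLang TBL (sndP (fstP w))))) w := by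
    intro i s _ _
    rw [tagQ_apply, Oracle.ofLanguage_apply, Oracle.ofLanguage_apply]
    by_cases hs : s ∈ oracleJoin B (tableLang TBL (sndP (fstP w)))
    · rw [(Set.mem_iff_boolIndicator _ _).1 hs,
        (Set.mem_iff_boolIndicator _ _).1 ((boolPair_mem_jointOracle B TBL _ s).2 hs)]
    · rw [(Set.notMem_iff_boolIndicator _ _).1 hs,
        (Set.notMem_iff_boolIndicator _ _).1 fun h => hs ((boolPair_mem_jointOracle B TBL _ s).1 h)]
  -- the genuine run, with enough fuel
  have hzw : (boolPair (fstP (fstP w)) (sndP w)).length ≤ w.length + 2 := by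
    rw [length_boolPair]
    have h1 := length_boolUnpair_parts_le w
    have h2 := length_boolUnpair_parts_le (boolUnpair w).1
    change 2 * (boolUnpair (boolUnpair w).1).1.length + 2 + (boolUnpair w).2.length ≤ w.length + 2
    omega
  have hfuel : q.eval (boolPair (fstP (fstP w)) (sndP w)).length ≤ (2 * X + 2 + q.comp (X + 2)).eval w.length := by
    simp only [eval_add, eval_mul, eval_ofNat, eval_X, eval_comp]
    have := TM2Iter.eval_mono q hzw
    omega
  obtain ⟨b, hb⟩ := Option.isSome_iff_exists.1
    (hwf (Oracle.ofLanguage (oracleJoin B (tableLang TBL (sndP (fstP w))))) (boolPair (fstP (fstP w)) (sndP w))).1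
  have hb' := OracleAlg.run_mono M (Oracle.ofLanguage (oracleJoin B (tableLang TBL (sndP (fstP w))))) _ hfuel hb
  have hrun : (simMachine M).run (Oracle.ofLanguage (jointOracle B TBL)) ((2 * X + 2 + q.comp (X + 2)).eval w.length) w =
      some b := by
    rw [simMachine, OracleAlg.run_mapQuery _ _ _ _ _ hagree]
    show (M.comap projIn).runAux _ w _ [] = some b
    rw [OracleAlg.runAux_comap, projIn_apply]
    exact hb'
  refine ⟨?_, fun s hs => ?_⟩
  · -- the output is the membership bit
    rw [hrun, Option.some.injEq]
    have hmem : w ∈ simRel B TBL M q ↔ b = true := by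
      show M.run (Oracle.ofLanguage (oracleJoin B (tableLang TBL (sndP (fstP w)))))
        (q.eval (boolPair (fstP (fstP w)) (sndP w)).length) (boolPair (fstP (fstP w)) (sndP w)) = some true ↔ _
      rw [hb, Option.some.injEq]
    rcases Bool.eq_false_or_eq_true b with rfl | rfl
    · exact ((Set.mem_iff_boolIndicator _ _).1 (hmem.2 rfl)).symm
    · exact ((Set.notMem_iff_boolIndicator _ _).1 fun h => Bool.false_ne_true (hmem.1 h)).symm
  · -- the queries are short
    unfold simMachine at hs
    obtain ⟨i, s₀, -, -, hs₀, hs₀eq⟩ := OracleAlg.queries_mapQuery (M.comap projIn) tagQ _ _ w hagree _ hs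
    have hs₀' : s₀ ∈ M.queries (Oracle.ofLanguage (oracleJoin B (tableLang TBL (sndP (fstP w)))))
        ((2 * X + 2 + q.comp (X + 2)).eval w.length) (boolPair (fstP (fstP w)) (sndP w)) := by
      have h := OracleAlg.queriesAux_comap M projIn
        (Oracle.ofLanguage (oracleJoin B (tableLang TBL (sndP (fstP w))))) w ((2 * X + 2 + q.comp (X + 2)).eval w.length) []
      unfold OracleAlg.queries at hs₀ ⊢
      rwa [h, projIn_apply] at hs₀
    -- queries with more fuel are queries of the genuine run, hence short
    have hshort : s₀.length ≤ q.eval (boolPair (fstP (fstP w)) (sndP w)).length := by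
      refine (hwf (Oracle.ofLanguage (oracleJoin B (tableLang TBL (sndP (fstP w)))))
        (boolPair (fstP (fstP w)) (sndP w))).2 s₀ ?_
      rwa [OracleAlg.queries_eq_of_run_eq_some M _ (boolPair (fstP (fstP w)) (sndP w)) hfuel hb] at hs₀'
    rw [hs₀eq, tagQ_apply, length_boolPair]
    have ht : (sndP (fstP w)).length ≤ w.length := by
      have h1 := length_boolUnpair_parts_le w
      have h2 := length_boolUnpair_parts_le (boolUnpair w).1
      change (boolUnpair (boolUnpair w).1).2.length ≤ w.length
      omega
    have hq : q.eval (boolPair (fstP (fstP w)) (sndP w)).length ≤ q.eval (w.length + 2) :=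
      TM2Iter.eval_mono q hzw
    simp only [eval_add, eval_mul, eval_ofNat, eval_X, eval_comp]
    omega

/-! ### The threshold form of the promise test against a table -/

/-- Counting witnesses along a pointwise correspondence of the witness relations at two base
points. [folklore] -/
theorem countWitnesses_congr_base {R R' : Language Bool} {m : ℕ} {u x : List Bool}
    (h : ∀ y : List.Vector Bool m, boolPair u y.toList ∈ R ↔ boolPair x y.toList ∈ R') :
    countWitnesses R m u = countWitnesses R' m x := by
  classical
  unfold countWitnesses
  congr 1
  exact Finset.filter_congr fun y _ => h y

/-- **The threshold test against a table**: the inputs `u = ⟨x, t⟩` with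
`2^{p(|x|)} < 2 · gap_Δ(B ⊕ Z_t, x)` — under the promise, "`Δ` accepts `x` relative to the table's
oracle" (`accTable_iff_mem_lang`). [cite: FennerFortnowKurtzLi2003IC, Lemma 6.17 (p. 33, the certificate tests) and Def. 6.1] -/
def accTable (B TBL : Language Bool) (Δ : AWPPDescr) : Language Bool :=
  {u | (2 : ℤ) ^ Δ.p.eval (fstP u).length < 2 * Δ.gap B (tableLang TBL (sndP u)) (fstP u)}

/-- Membership of a pair in the threshold test. [folklore] -/
theorem boolPair_mem_accTable (B TBL : Language Bool) (Δ : AWPPDescr) (x t : List Bool) :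
    boolPair x t ∈ accTable B TBL Δ ↔
      (2 : ℤ) ^ Δ.p.eval x.length < 2 * Δ.gap B (tableLang TBL t) x := by
  show (2 : ℤ) ^ Δ.p.eval (fstP (boolPair x t)).length <
    2 * Δ.gap B (tableLang TBL (sndP (boolPair x t))) (fstP (boolPair x t)) ↔ _
  rw [fstP_boolPair, sndP_boolPair]

/-- The counts of the description against the table's oracle are the witness counts of the
simulated relations. [cite: FennerFortnowKurtzLi2003IC, Lemma 6.17 (p. 33)] -/
theorem cnt₁_eq_countWitnesses_simRel (B TBL : Language Bool) (Δ : AWPPDescr) (u : List Bool) :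
    Δ.cnt₁ B (tableLang TBL (sndP u)) (fstP u) =
      countWitnesses (simRel B TBL Δ.M₁ Δ.q₁) (Δ.r₁.eval (fstP u).length) u := by
  refine (countWitnesses_congr_base fun y => ?_).symm
  show Δ.M₁.run (Oracle.ofLanguage (oracleJoin B (tableLang TBL (sndP (fstP (boolPair u y.toList))))))
      (Δ.q₁.eval (boolPair (fstP (fstP (boolPair u y.toList))) (sndP (boolPair u y.toList))).length)
      (boolPair (fstP (fstP (boolPair u y.toList))) (sndP (boolPair u y.toList))) = some true ↔
    Δ.M₁.run (Oracle.ofLanguage (oracleJoin B (tableLang TBL (sndP u))))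
      (Δ.q₁.eval (boolPair (fstP u) y.toList).length) (boolPair (fstP u) y.toList) = some true
  rw [fstP_boolPair, sndP_boolPair]

/-- The same for the second machine. [cite: FennerFortnowKurtzLi2003IC, Lemma 6.17 (p. 33)] -/
theorem cnt₂_eq_countWitnesses_simRel (B TBL : Language Bool) (Δ : AWPPDescr) (u : List Bool) :
    Δ.cnt₂ B (tableLang TBL (sndP u)) (fstP u) =
      countWitnesses (simRel B TBL Δ.M₂ Δ.q₂) (Δ.r₂.eval (fstP u).length) u := by
  refine (countWitnesses_congr_base fun y => ?_).symm
  show Δ.M₂.run (Oracle.ofLanguage (oracleJoin B (tableLang TBL (sndP (fstP (boolPair u y.toList))))))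
      (Δ.q₂.eval (boolPair (fstP (fstP (boolPair u y.toList))) (sndP (boolPair u y.toList))).length)
      (boolPair (fstP (fstP (boolPair u y.toList))) (sndP (boolPair u y.toList))) = some true ↔
    Δ.M₂.run (Oracle.ofLanguage (oracleJoin B (tableLang TBL (sndP u))))
      (Δ.q₂.eval (boolPair (fstP u) y.toList).length) (boolPair (fstP u) y.toList) = some true
  rw [fstP_boolPair, sndP_boolPair]

/-- **The threshold test against a table is a `PSPACE` predicate** for a well-formed description,
`B, TBL ∈ PSPACE` and a Karp-`PSPACE`-complete set at hand ("it is easy to see that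
`F_j ∈ FPSPACE` for `C^A = AWPP^A`": the two counts are witness counts of polynomial-space
relations, compared against `2^{p(|x|)}/2`, `gapThreshold_mem_PSPACE`).
[cite: FennerFortnowKurtzLi2003IC, Lemma 6.17 and the remark following it (p. 33)] -/
theorem accTable_mem_PSPACE {B TBL C : Language Bool} (hC : IsComplete PSPACE C) (hB : B ∈ PSPACE)
    (hT : TBL ∈ PSPACE) {Δ : AWPPDescr} (hwf : Δ.WellFormed) : accTable B TBL Δ ∈ PSPACE := by
  obtain ⟨hM₁, hM₂, hwf₁, hwf₂⟩ := hwf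
  have h := gapThreshold_mem_PSPACE hC (simRel_mem_PSPACE hC hB hT hM₁ Δ.q₁ hwf₁)
    (simRel_mem_PSPACE hC hB hT hM₂ Δ.q₂ hwf₂) Δ.r₁ Δ.r₂ Δ.p
  have heq : accTable B TBL Δ = {u : List Bool | (2 : ℤ) ^ Δ.p.eval (fstP u).length <
      2 * ((countWitnesses (simRel B TBL Δ.M₁ Δ.q₁) (Δ.r₁.eval (fstP u).length) u : ℤ) -
        (countWitnesses (simRel B TBL Δ.M₂ Δ.q₂) (Δ.r₂.eval (fstP u).length) u : ℤ))} := by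
    refine Set.ext fun u => ?_
    show (2 : ℤ) ^ Δ.p.eval (fstP u).length < 2 * Δ.gap B (tableLang TBL (sndP u)) (fstP u) ↔
      (2 : ℤ) ^ Δ.p.eval (fstP u).length <
        2 * ((countWitnesses (simRel B TBL Δ.M₁ Δ.q₁) (Δ.r₁.eval (fstP u).length) u : ℤ) -
          (countWitnesses (simRel B TBL Δ.M₂ Δ.q₂) (Δ.r₂.eval (fstP u).length) u : ℤ))
    rw [AWPPDescr.gap, cnt₁_eq_countWitnesses_simRel, cnt₂_eq_countWitnesses_simRel]
  rw [heq]
  exact h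

/-- **The threshold is the verdict under the promise**: if `Δ.Prom B Z x` holds (gap in
`[0, 2^p/3] ∪ [2·2^p/3, 2^p]`), then `2^p < 2·gap ↔ x ∈ Δ.lang B Z` (`2·2^p ≤ 3·gap`).
[cite: FennerFortnowKurtzLi2003IC, Def. 6.1 (p. 25)] -/
theorem threshold_iff_mem_lang {B Z : Language Bool} {Δ : AWPPDescr} {x : List Bool}
    (h : Δ.Prom B Z x) :
    (2 : ℤ) ^ Δ.p.eval x.length < 2 * Δ.gap B Z x ↔ x ∈ Δ.lang B Z := by
  show _ ↔ 2 * (2 : ℤ) ^ Δ.p.eval x.length ≤ 3 * Δ.gap B Z x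
  have hpos : (0 : ℤ) < 2 ^ Δ.p.eval x.length := by positivity
  rcases h with ⟨h1, h2⟩ | ⟨h1, h2⟩
  · constructor
    · intro _; exact h1
    · intro _; nlinarith
  · constructor
    · intro hlt; nlinarith
    · intro hle; nlinarith

/-- **The table test decides the description under the promise**: for a table code `t` whose
oracle `Z_t` satisfies the promise of `Δ` at `x` (e.g. `Z_t` extends a condition over which `Δ` is
categorical), `⟨x, t⟩ ∈ accTable ↔ x ∈ Δ.lang B Z_t`.
[cite: FennerFortnowKurtzLi2003IC, Lemma 6.17 (p. 33) with Def. 6.1] -/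
theorem boolPair_mem_accTable_iff_mem_lang {B TBL : Language Bool} {Δ : AWPPDescr} {x t : List Bool}
    (h : Δ.Prom B (tableLang TBL t) x) :
    boolPair x t ∈ accTable B TBL Δ ↔ x ∈ Δ.lang B (tableLang TBL t) := by
  rw [boolPair_mem_accTable]
  exact threshold_iff_mem_lang h

end FFKL

end Literature.Barriers.QuantumAdvantage

end
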